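import Mathlib
import HarnessLib
import Literature.MathematicalPhysics.QuantumLattice.HubbardUVSymbolSmooth
import Literature.Analysis.SpecialFunctions.MatsubaraLorentzianSum

/-!
# Route `KLProgramme` — crux C4a, S3 brick (B4) «(B4)-UMK1», «(M1)-TRUE-KERNEL» analytic half, part 1: the REAL NUMERATOR of the Matsubara-summed
# above-scale pp pair kernel (all fermionic frequencies, Salmhofer cutoff, zero transfer frequency) — level derivatives everywhere, and their
# CANCELLATION-RESPECTING sizes on the finer-line split's support

Cell `gate-hubbard-kl`, seat hubbard-kl-k3c3-p1 (g15; row «δμ-flow with klAngularMean constant piece»).  Located brick for the (U1) chain of hubbard-kl-k3c3-p3 / the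
(C)-closer lane (stub (C) `stub_twoLeg_curvature` of `KLRegimeEngineV17F2`, stmt-HubbardSuperconductivity-20437); companion of `…C4aPPKernelRatioForm` (structural half,
finite frequency sets) and of this seat's located note `M1-TRUE-KERNEL.md` (evidence #45).  MODEL OF RECORD (the note's §2): inverse temperature `β > 0`, frequencies
`ωₙ = (2n+1)π/β` paired `±ωₙ` (`n ≥ 0`), above-scale weight `W(ω,x) = uvWeightFn Λ ω x = χ((x²+ω²)/Λ²)`, transfer frequency `Ω = 0`; by `…RatioForm` the pair kernel is
`N(e,u)/(e+u)` with the REAL numerator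
  `N(e,u) = (2/β)·Σ_{n≥0} W(ωₙ,e)·W(ωₙ,u)·[e/(ωₙ²+e²) + u/(ωₙ²+u²)]`   (`ppTrueNumerator β Λ e u`; the imaginary parts cancel in the `±ωₙ` pairing).
* §1 `ppFreq`, positivity, the Lorentzian bounds `|x/(ω²+x²)| ≤ 1/|x|`-free forms, `|∂ₓ[x/(ω²+x²)]| ≤ 1/(ω²+x²)`, and two COUNTING-FREE shell majorants:
  `1 − W(ωₙ,e) ≤ 2Λ²/(ωₙ²+Λ²)` and `|W′(ωₙ,x)| ≤ (2B₁/Λ)·2Λ²/(ωₙ²+Λ²)` (the shell lives at `ωₙ ≤ Λ`; `(2/β)Σₙ 2Λ²/(ωₙ²+Λ²) = Λ·tanh(βΛ/2) ≤ Λ` replaces `#{ωₙ ≤ Λ}`);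
* §2 `ppTrueNumerator`, `ppTrueNumeratorDu` (the `u`-derivative series), symmetry `N(e,u) = N(u,e)`, summability, and **`hasDerivAt_ppTrueNumerator_u / _e`** (termwise
  differentiation EVERYWHERE, Mathlib `hasDerivAt_tsum` with the summable dominator of §1);
* §3 (companion file `…C4aPPKernelTrueNumeratorFar`) the FAR REGION `Λ < u` (the finer-line split's support): `ppTrueNumeratorDu_of_far` (`∂ᵤN = (2/β)Σ W(ωₙ,e)·(ωₙ²−u²)/(ωₙ²+u²)²` — no cutoff derivative),
  **`ppTrueNumeratorDu_of_far_of_far`** (`Λ < e` too: `∂ᵤN = (β/4)·sech²(βu/2)` EXACTLY — the cancellation across frequencies of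
  `Literature…tsum_matsubara_lorentzian_deriv`), **`abs_ppTrueNumeratorDu_far_le`** (`|∂ᵤN| ≤ (β/4)sech²(βu/2) + Λ/u²` for every `e`), and for the loop-level derivative
  **`abs_ppTrueNumeratorDe_far_le`** (`|∂ₑN| ≤ (10B₁ + 5/2)/Λ` for every `e`, `B₁ = sup|χ′|`) with the exact `(β/4)sech²(βe/2)` once `Λ < e`.
These are the `n₁ = ∂ₑN`, `n₂ = ∂ᵤN` sizes of `…C4aAntidiagonalFlatnessL1.abs_integral_antidiagonal_flatness_le_of_L1` for the true kernel (the note's §2 targets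
`sup|∂ₑN| ≈ 1/Λ`, `sup_{split}|∂ᵤN| ≈ 0.26Λ/u²`); the weighted-L¹ integrals and the flatness instance are part 2 (`…C4aPPKernelTrueFlatness`).  NEVER a `W = 1 − (1−W)` split
below the shell (that produces `1/T` artefacts); never an absolute value per frequency on the `W ≡ 1` part (that costs `log(D/Λ)`, note finding (v)).
Pure real analysis on Literature objects; nothing asserts (C), K3 or superconductivity.
References: BGM 2006 §2.1 (2.3), §2.4 [cite: BenfattoGiulianiMastropietro2006]; Salmhofer 1999 §4.2.5 (4.70)–(4.71) [cite: Salmhofer1999].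
-/

noncomputable section

namespace Summit.HubbardSuperconductivity.HubbardSuperconductivity.Theorems.C4a

set_option linter.dupNamespace false -- summit = problem name (single-conjunct summit), D-0017

open Real Filter Set
open scoped Topology
open Literature.MathematicalPhysics.QuantumLattice Literature.Analysis.SpecialFunctions

/-! ## §1 Frequencies, Lorentzians and the two counting-free shell majorants -/

/-- The nonnegative fermionic Matsubara frequencies `ωₙ = (2n+1)π/β`. -/
def ppFreq (β : ℝ) (n : ℕ) : ℝ := (2 * n + 1) * π / β

/-- `ωₙ > 0`. [folklore] -/
theorem ppFreq_pos {β : ℝ} (hβ : 0 < β) (n : ℕ) : 0 < ppFreq β n := by unfold ppFreq; positivity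

/-- `π/β ≤ ωₙ`. [folklore] -/
theorem pi_div_le_ppFreq {β : ℝ} (hβ : 0 < β) (n : ℕ) : π / β ≤ ppFreq β n := by
  unfold ppFreq
  rw [div_le_div_iff_of_pos_right hβ]
  have hn : (0 : ℝ) ≤ n := n.cast_nonneg
  nlinarith [Real.pi_pos]

/-- `Σₙ 1/(ωₙ² + a²)` converges. [cite: BenfattoGiulianiMastropietro2006, §2.1 (2.2)-(2.5)] -/
theorem summable_one_div_ppFreq_sq_add_sq {β : ℝ} (hβ : 0 < β) (a : ℝ) : Summable fun n : ℕ => 1 / (ppFreq β n ^ 2 + a ^ 2) := by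
  simpa [ppFreq] using summable_one_div_matsubara_sq_add_sq hβ a

/-- `Σₙ 1/(ωₙ² + a²) = β·tanh(βa/2)/(4a)` (`a ≠ 0`). [cite: BenfattoGiulianiMastropietro2006, §2.1 (2.2)-(2.5)] -/
theorem tsum_one_div_ppFreq_sq_add_sq {β : ℝ} (hβ : 0 < β) {a : ℝ} (ha : a ≠ 0) :
    ∑' n : ℕ, 1 / (ppFreq β n ^ 2 + a ^ 2) = β * Real.tanh (β * a / 2) / (4 * a) := by
  simpa [ppFreq] using tsum_one_div_matsubara_sq_add_sq hβ ha

/-- The shell mass without counting: `(2/β)·Σₙ 2Λ²/(ωₙ² + Λ²) = Λ·tanh(βΛ/2) ≤ Λ`. [cite: BenfattoGiulianiMastropietro2006, §2.1 (2.2)-(2.5)] -/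
theorem two_div_mul_tsum_shell_le {β Λ : ℝ} (hβ : 0 < β) (hΛ : 0 < Λ) :
    2 / β * ∑' n : ℕ, 2 * Λ ^ 2 / (ppFreq β n ^ 2 + Λ ^ 2) ≤ Λ := by
  have h1 : ∑' n : ℕ, 2 * Λ ^ 2 / (ppFreq β n ^ 2 + Λ ^ 2) = 2 * Λ ^ 2 * ∑' n : ℕ, 1 / (ppFreq β n ^ 2 + Λ ^ 2) := by
    rw [← tsum_mul_left]; exact tsum_congr fun n => by ring
  rw [h1, tsum_one_div_ppFreq_sq_add_sq hβ hΛ.ne']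
  have ht : Real.tanh (β * Λ / 2) ≤ 1 := (Real.tanh_lt_one _).le
  have hβ0 : β ≠ 0 := hβ.ne'
  calc 2 / β * (2 * Λ ^ 2 * (β * Real.tanh (β * Λ / 2) / (4 * Λ))) = Λ * Real.tanh (β * Λ / 2) := by field_simp; ring
    _ ≤ Λ * 1 := mul_le_mul_of_nonneg_left ht hΛ.le
    _ = Λ := mul_one Λ

/-- The Lorentzian is bounded by the inverse of its own denominator: `|x/(ω² + x²)| ≤ |x|/(ω² + x²)` with `ω² + x² > 0` trivially; the useful forms are
`|x/(ω²+x²)| ≤ 1/u`-type bounds: `0 < x ⟹ x/(ω²+x²) ≤ 1/x`. [folklore] -/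
theorem lorentzian_le_inv {ω x : ℝ} (hx : 0 < x) : x / (ω ^ 2 + x ^ 2) ≤ 1 / x := by
  rw [div_le_div_iff₀ (by positivity) hx]
  nlinarith [sq_nonneg ω]

/-- `0 ≤ x ⟹ 0 ≤ x/(ω²+x²)`. [folklore] -/
theorem lorentzian_nonneg (ω : ℝ) {x : ℝ} (hx : 0 ≤ x) : 0 ≤ x / (ω ^ 2 + x ^ 2) := div_nonneg hx (by positivity)

/-- `|x/(ω² + x²)| ≤ |x|/ω²` (`ω ≠ 0`) — the summable-in-`n` form at fixed level. [folklore] -/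
theorem abs_lorentzian_le_abs_div_sq {ω : ℝ} (hω : ω ≠ 0) (x : ℝ) : |x / (ω ^ 2 + x ^ 2)| ≤ |x| / ω ^ 2 := by
  have hω2 : 0 < ω ^ 2 := by positivity
  rw [abs_div, abs_of_pos (by positivity : (0 : ℝ) < ω ^ 2 + x ^ 2)]
  exact div_le_div_of_nonneg_left (abs_nonneg x) hω2 (by nlinarith [sq_nonneg x])

/-- `|∂ₓ[x/(ω²+x²)]| = |(ω² − x²)/(ω² + x²)²| ≤ 1/(ω² + x²)` (`ω² + x² > 0`). [folklore] -/
theorem abs_lorentzian_deriv_le_inv {ω x : ℝ} (h : 0 < ω ^ 2 + x ^ 2) : |(ω ^ 2 - x ^ 2) / (ω ^ 2 + x ^ 2) ^ 2| ≤ 1 / (ω ^ 2 + x ^ 2) := by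
  rw [abs_div, abs_of_pos (pow_pos h 2), div_le_div_iff₀ (pow_pos h 2) h, one_mul]
  have h1 : |ω ^ 2 - x ^ 2| ≤ ω ^ 2 + x ^ 2 := by
    rw [abs_le]; constructor <;> nlinarith [sq_nonneg x, sq_nonneg ω]
  calc |ω ^ 2 - x ^ 2| * (ω ^ 2 + x ^ 2) ≤ (ω ^ 2 + x ^ 2) * (ω ^ 2 + x ^ 2) := mul_le_mul_of_nonneg_right h1 h.le
    _ = (ω ^ 2 + x ^ 2) ^ 2 := by ring

/-- `B₁ ≥ 0` from the derivative bound of the cutoff. [folklore] -/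
theorem salmhoferB₁_nonneg {B₁ : ℝ} (hB₁ : ∀ x, |deriv salmhoferCutoff x| ≤ B₁) : 0 ≤ B₁ := (abs_nonneg _).trans (hB₁ 0)

/-- **Counting-free shell majorant of the weight defect**: `0 ≤ 1 − W(ω,e) ≤ 2Λ²/(ω² + Λ²)` (`Λ > 0`): the defect vanishes above the shell and the shell has
`ω² ≤ Λ²`. [cite: Salmhofer1999, §4.2.5 (4.71)] -/
theorem one_sub_uvWeightFn_le_shell {Λ : ℝ} (hΛ : 0 < Λ) (ω e : ℝ) :
    0 ≤ 1 - uvWeightFn Λ ω e ∧ 1 - uvWeightFn Λ ω e ≤ 2 * Λ ^ 2 / (ω ^ 2 + Λ ^ 2) := by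
  have hW := uvWeightFn_mem_Icc Λ ω e
  refine ⟨by linarith [hW.2], ?_⟩
  by_cases h : Λ ^ 2 < e ^ 2 + ω ^ 2
  · rw [(uvWeightFn_eq_one_of_gt hΛ h).1, sub_self]; positivity
  · have hω : ω ^ 2 ≤ Λ ^ 2 := by nlinarith [not_lt.1 h, sq_nonneg e]
    rw [le_div_iff₀ (by positivity)]
    nlinarith [hW.1, hW.2]

/-- **Counting-free shell majorant of the weight's level derivative**: `|W′(ω,x)| ≤ (2B₁/Λ)·2Λ²/(ω² + Λ²)` (`Λ > 0`): `|W′| ≤ 2B₁/Λ` everywhere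
(`abs_uvWeightFnD1_le`) and `W′ = 0` unless `x² + ω² ≤ Λ²`. [cite: Salmhofer1999, §4.2.5 (4.71)] -/
theorem abs_uvWeightFnD1_le_shell {B₁ : ℝ} (hB₁ : ∀ x, |deriv salmhoferCutoff x| ≤ B₁) {Λ : ℝ} (hΛ : 0 < Λ) (ω x : ℝ) :
    |uvWeightFnD1 Λ ω x| ≤ 2 * B₁ / Λ * (2 * Λ ^ 2 / (ω ^ 2 + Λ ^ 2)) := by
  have hB0 := salmhoferB₁_nonneg hB₁
  by_cases h : Λ ^ 2 < x ^ 2 + ω ^ 2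
  · rw [(uvWeightFn_eq_one_of_gt hΛ h).2.1, abs_zero]; positivity
  · have hω : ω ^ 2 ≤ Λ ^ 2 := by nlinarith [not_lt.1 h, sq_nonneg x]
    have h1 : 1 ≤ 2 * Λ ^ 2 / (ω ^ 2 + Λ ^ 2) := by rw [le_div_iff₀ (by positivity)]; nlinarith
    calc |uvWeightFnD1 Λ ω x| ≤ 2 * B₁ / Λ := abs_uvWeightFnD1_le hB₁ hΛ ω x
      _ = 2 * B₁ / Λ * 1 := (mul_one _).symm
      _ ≤ 2 * B₁ / Λ * (2 * Λ ^ 2 / (ω ^ 2 + Λ ^ 2)) := mul_le_mul_of_nonneg_left h1 (by positivity)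

/-- Where the weight is nonzero the line is outside the half shell: `W(ω,e) ≠ 0 ⟹ Λ²/4 ≤ e² + ω²`. [cite: Salmhofer1999, §4.2.5 (4.71)] -/
theorem sq_add_sq_ge_of_uvWeightFn_ne_zero {Λ : ℝ} (hΛ : 0 < Λ) {ω e : ℝ} (hW : uvWeightFn Λ ω e ≠ 0) : Λ ^ 2 / 4 ≤ e ^ 2 + ω ^ 2 := by
  by_contra h
  exact hW (uvWeightFn_eq_zero_of_lt hΛ (not_le.1 h)).1

/-- **The weighted Lorentzian derivative is shell-summable WITHOUT splitting the weight**: `|W(ω,e)·(ω²−e²)/(ω²+e²)²| ≤ 5/(ω² + Λ²)` (`Λ > 0`, `ω ≠ 0`):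
where `W ≠ 0`, `ω² + e² ≥ Λ²/4`, so `ω² + Λ² ≤ 5(ω² + e²)`. [cite: Salmhofer1999, §4.2.5 (4.71)] -/
theorem abs_uvWeightFn_mul_lorentzian_deriv_le {Λ : ℝ} (hΛ : 0 < Λ) {ω : ℝ} (hω : ω ≠ 0) (e : ℝ) :
    |uvWeightFn Λ ω e * ((ω ^ 2 - e ^ 2) / (ω ^ 2 + e ^ 2) ^ 2)| ≤ 5 / (ω ^ 2 + Λ ^ 2) := by
  by_cases hW : uvWeightFn Λ ω e = 0
  · rw [hW, zero_mul, abs_zero]; positivity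
  · have hs : Λ ^ 2 / 4 ≤ e ^ 2 + ω ^ 2 := sq_add_sq_ge_of_uvWeightFn_ne_zero hΛ hW
    have hpos : 0 < ω ^ 2 + e ^ 2 := by positivity
    rw [abs_mul]
    have h1 : |uvWeightFn Λ ω e| ≤ 1 := abs_uvWeightFn_le_one Λ ω e
    have h2 := abs_lorentzian_deriv_le_inv hpos
    calc |uvWeightFn Λ ω e| * |(ω ^ 2 - e ^ 2) / (ω ^ 2 + e ^ 2) ^ 2| ≤ 1 * (1 / (ω ^ 2 + e ^ 2)) :=
          mul_le_mul h1 h2 (abs_nonneg _) zero_le_one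
      _ = 1 / (ω ^ 2 + e ^ 2) := one_mul _
      _ ≤ 5 / (ω ^ 2 + Λ ^ 2) := by
          rw [div_le_div_iff₀ hpos (by positivity)]
          nlinarith

/-- **The weight derivative times the two Lorentzians is shell-summable**: for `0 < Λ < u`,
`|W′(ω,e)·(u/(ω²+u²) + e/(ω²+e²))| ≤ 20B₁/(ω² + Λ²)` (where `W′ ≠ 0`: `|e| ≤ Λ`, `ω² + e² ≥ Λ²/4`, so the Lorentzians are `≤ 1/Λ` and `≤ 4/Λ`).
[cite: Salmhofer1999, §4.2.5 (4.71)] -/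
theorem abs_uvWeightFnD1_mul_lorentzians_le {B₁ : ℝ} (hB₁ : ∀ x, |deriv salmhoferCutoff x| ≤ B₁) {Λ u : ℝ} (hΛ : 0 < Λ) (hu : Λ < u) {ω : ℝ} (hω : ω ≠ 0)
    (e : ℝ) : |uvWeightFnD1 Λ ω e * (u / (ω ^ 2 + u ^ 2) + e / (ω ^ 2 + e ^ 2))| ≤ 20 * B₁ / (ω ^ 2 + Λ ^ 2) := by
  have hB0 := salmhoferB₁_nonneg hB₁
  have hu0 : 0 < u := hΛ.trans hu
  by_cases hlo : e ^ 2 + ω ^ 2 < Λ ^ 2 / 4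
  · rw [(uvWeightFn_eq_zero_of_lt hΛ hlo).2.1, zero_mul, abs_zero]; positivity
  by_cases hhi : Λ ^ 2 < e ^ 2 + ω ^ 2
  · rw [(uvWeightFn_eq_one_of_gt hΛ hhi).2.1, zero_mul, abs_zero]; positivity
  have hs1 : Λ ^ 2 / 4 ≤ e ^ 2 + ω ^ 2 := not_lt.1 hlo
  have hs2 : e ^ 2 + ω ^ 2 ≤ Λ ^ 2 := not_lt.1 hhi
  have hpos : 0 < ω ^ 2 + e ^ 2 := by positivity
  -- the two Lorentzians on the shell
  have hLu : |u / (ω ^ 2 + u ^ 2)| ≤ 1 / Λ := by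
    rw [abs_of_nonneg (lorentzian_nonneg ω hu0.le)]
    exact (lorentzian_le_inv hu0).trans (by rw [div_le_div_iff₀ hu0 hΛ]; linarith)
  have hLe : |e / (ω ^ 2 + e ^ 2)| ≤ 4 / Λ := by
    rw [abs_div, abs_of_pos hpos, div_le_div_iff₀ hpos hΛ]
    have he : |e| ≤ Λ := abs_le_of_sq_le_sq' (by nlinarith [sq_nonneg ω]) hΛ.le |>.2 |> fun h => abs_le.2 ⟨(abs_le_of_sq_le_sq' (by nlinarith [sq_nonneg ω]) hΛ.le).1, h⟩
    calc |e| * Λ ≤ Λ * Λ := mul_le_mul_of_nonneg_right he hΛ.le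
      _ = Λ ^ 2 := (sq Λ).symm
      _ ≤ 4 * (ω ^ 2 + e ^ 2) := by nlinarith
  have hW := abs_uvWeightFnD1_le_shell hB₁ hΛ ω e
  rw [abs_mul]
  have hsum : |u / (ω ^ 2 + u ^ 2) + e / (ω ^ 2 + e ^ 2)| ≤ 5 / Λ := by
    refine (abs_add_le _ _).trans ?_
    calc |u / (ω ^ 2 + u ^ 2)| + |e / (ω ^ 2 + e ^ 2)| ≤ 1 / Λ + 4 / Λ := add_le_add hLu hLe
      _ = 5 / Λ := by ring
  calc |uvWeightFnD1 Λ ω e| * |u / (ω ^ 2 + u ^ 2) + e / (ω ^ 2 + e ^ 2)|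
      ≤ 2 * B₁ / Λ * (2 * Λ ^ 2 / (ω ^ 2 + Λ ^ 2)) * (5 / Λ) := mul_le_mul hW hsum (abs_nonneg _) (by positivity)
    _ = 20 * B₁ / (ω ^ 2 + Λ ^ 2) := by field_simp; ring

/-! ## §2 The numerator, its symmetry and its level derivatives everywhere -/

/-- **The real numerator of the true pp pair kernel** (`Ω = 0`, all fermionic frequencies, above-scale Salmhofer weights at scale `Λ`):
`N(e,u) = (2/β)·Σ_{n≥0} W(ωₙ,e)·W(ωₙ,u)·[e/(ωₙ²+e²) + u/(ωₙ²+u²)]`. -/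
def ppTrueNumerator (β Λ e u : ℝ) : ℝ :=
  2 / β * ∑' n : ℕ, uvWeightFn Λ (ppFreq β n) e * uvWeightFn Λ (ppFreq β n) u *
    (e / (ppFreq β n ^ 2 + e ^ 2) + u / (ppFreq β n ^ 2 + u ^ 2))

/-- **The `u`-derivative series of the numerator**: `∂ᵤN(e,u) = (2/β)·Σₙ W(ωₙ,e)·[W′(ωₙ,u)·(e/(ωₙ²+e²) + u/(ωₙ²+u²)) + W(ωₙ,u)·(ωₙ²−u²)/(ωₙ²+u²)²]`
(by the symmetry `N(e,u) = N(u,e)`, `∂ₑN(e,u) = ppTrueNumeratorDu β Λ u e`). -/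
def ppTrueNumeratorDu (β Λ e u : ℝ) : ℝ :=
  2 / β * ∑' n : ℕ, uvWeightFn Λ (ppFreq β n) e *
    (uvWeightFnD1 Λ (ppFreq β n) u * (e / (ppFreq β n ^ 2 + e ^ 2) + u / (ppFreq β n ^ 2 + u ^ 2)) +
      uvWeightFn Λ (ppFreq β n) u * ((ppFreq β n ^ 2 - u ^ 2) / (ppFreq β n ^ 2 + u ^ 2) ^ 2))

/-- **Symmetry** `N(e,u) = N(u,e)`. [folklore] -/
theorem ppTrueNumerator_symm (β Λ e u : ℝ) : ppTrueNumerator β Λ e u = ppTrueNumerator β Λ u e := by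
  unfold ppTrueNumerator
  congr 1
  exact tsum_congr fun n => by ring

/-- The summable dominator of the derivative series: `(2B₁/Λ)·(2Λ²/(ωₙ²+Λ²))·(2β/π)·… `— concretely
`dom n = (2B₁/Λ)·(2Λ²/(ωₙ²+Λ²))·(β/π)·(|e|·(β/π) + 1) + 1/ωₙ²`-free form used below. [folklore] -/
theorem summable_ppDominator {β Λ : ℝ} (hβ : 0 < β) (B₁ c : ℝ) :
    Summable fun n : ℕ => 2 * B₁ / Λ * (2 * Λ ^ 2 / (ppFreq β n ^ 2 + Λ ^ 2)) * c + 1 / (ppFreq β n ^ 2 + 0 ^ 2) := by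
  refine Summable.add ?_ (summable_one_div_ppFreq_sq_add_sq hβ 0)
  have h := (summable_one_div_ppFreq_sq_add_sq hβ Λ).mul_left (2 * B₁ / Λ * (2 * Λ ^ 2) * c)
  refine h.congr fun n => ?_
  field_simp

/-- **`∂ᵤN` exists everywhere and is the series `ppTrueNumeratorDu`** (termwise differentiation; dominator from the shell majorant of `W′`, the bound
`|x/(ω²+x²)| ≤ |x|/ω² ≤ |x|β²/π²·…`-free form `≤ (β/π)·…`, and `|∂Lorentzian| ≤ 1/ω²`). [cite: BenfattoGiulianiMastropietro2006, §2.4 (2.36)] -/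
theorem hasDerivAt_ppTrueNumerator_u {β Λ : ℝ} (hβ : 0 < β) (hΛ : 0 < Λ) {B₁ : ℝ} (hB₁ : ∀ x, |deriv salmhoferCutoff x| ≤ B₁) (e u : ℝ) :
    HasDerivAt (fun v => ppTrueNumerator β Λ e v) (ppTrueNumeratorDu β Λ e u) u := by
  have hB0 := salmhoferB₁_nonneg hB₁
  unfold ppTrueNumerator ppTrueNumeratorDu
  refine HasDerivAt.const_mul (2 / β) ?_
  -- the dominator: |e|-dependent through the Lorentzian of the loop line, `|e/(ω²+e²)| ≤ |e|/ω²`, and `|v/(ω²+v²)| ≤ 1/(2ω) ≤ β/(2π)` uniformly in `v`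
  have hω : ∀ n : ℕ, 0 < ppFreq β n := ppFreq_pos hβ
  have hωπ : ∀ n : ℕ, 1 / ppFreq β n ≤ β / π := fun n => by
    rw [div_le_div_iff₀ (hω n) Real.pi_pos, one_mul]
    have := pi_div_le_ppFreq hβ n
    rw [div_le_iff₀ hβ] at this
    linarith
  refine hasDerivAt_tsum (u := fun n : ℕ => 2 * B₁ / Λ * (2 * Λ ^ 2 / (ppFreq β n ^ 2 + Λ ^ 2)) * (|e| * (β / π) ^ 2 + β / π) +
      1 / (ppFreq β n ^ 2 + 0 ^ 2))
    (g := fun (n : ℕ) (v : ℝ) => uvWeightFn Λ (ppFreq β n) e * uvWeightFn Λ (ppFreq β n) v *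
      (e / (ppFreq β n ^ 2 + e ^ 2) + v / (ppFreq β n ^ 2 + v ^ 2)))
    (g' := fun (n : ℕ) (v : ℝ) => uvWeightFn Λ (ppFreq β n) e *
      (uvWeightFnD1 Λ (ppFreq β n) v * (e / (ppFreq β n ^ 2 + e ^ 2) + v / (ppFreq β n ^ 2 + v ^ 2)) +
        uvWeightFn Λ (ppFreq β n) v * ((ppFreq β n ^ 2 - v ^ 2) / (ppFreq β n ^ 2 + v ^ 2) ^ 2)))
    (summable_ppDominator hβ B₁ _) (fun n v => ?_) (fun n v => ?_) (y₀ := 0) ?_ u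
  · -- termwise derivative
    have hW : HasDerivAt (fun v => uvWeightFn Λ (ppFreq β n) v) (uvWeightFnD1 Λ (ppFreq β n) v) v := hasDerivAt_uvWeightFn Λ (ppFreq β n) v
    have hL : HasDerivAt (fun y : ℝ => y / (ppFreq β n ^ 2 + y ^ 2)) ((ppFreq β n ^ 2 - v ^ 2) / (ppFreq β n ^ 2 + v ^ 2) ^ 2) v :=
      hasDerivAt_lorentzian (ppFreq β n) (by have := hω n; positivity)
    have h := ((hW.fun_mul (hL.const_add (e / (ppFreq β n ^ 2 + e ^ 2)))).const_mul (uvWeightFn Λ (ppFreq β n) e))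
    refine (h.congr_of_eventuallyEq (Eventually.of_forall fun y => by ring)).congr_deriv ?_
    ring
  · -- the dominator
    rw [Real.norm_eq_abs, abs_mul]
    have hWe : |uvWeightFn Λ (ppFreq β n) e| ≤ 1 := abs_uvWeightFn_le_one _ _ _
    have hWv : |uvWeightFn Λ (ppFreq β n) v| ≤ 1 := abs_uvWeightFn_le_one _ _ _
    have hD1 := abs_uvWeightFnD1_le_shell hB₁ hΛ (ppFreq β n) v
    have hLe : |e / (ppFreq β n ^ 2 + e ^ 2)| ≤ |e| * (β / π) ^ 2 := by
      refine (abs_lorentzian_le_abs_div_sq (hω n).ne' e).trans ?_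
      rw [div_eq_mul_one_div]
      refine mul_le_mul_of_nonneg_left ?_ (abs_nonneg e)
      rw [one_div_le (pow_pos (hω n) 2) (by positivity)]
      have h1 := hωπ n
      have h2 : 0 < β / π := by positivity
      calc 1 / (β / π) ^ 2 = (1 / (β / π)) ^ 2 := by rw [one_div_pow]
        _ ≤ ppFreq β n ^ 2 := by
            have h3 : 1 / (β / π) ≤ ppFreq β n := by
              rw [one_div_le h2 (hω n)]; exact h1
            exact pow_le_pow_left₀ (by positivity) h3 2
    have hLv : |v / (ppFreq β n ^ 2 + v ^ 2)| ≤ β / π := by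
      rcases le_or_gt v 0 with hv | hv
      · rcases eq_or_lt_of_le hv with rfl | hv'
        · simp; positivity
        · rw [abs_of_neg (div_neg_of_neg_of_pos hv' (by have := hω n; positivity))]
          have := lorentzian_le_inv (ω := ppFreq β n) (neg_pos.2 hv')
          rw [neg_sq] at this
          have h4 : 1 / (-v) ≤ β / π ∨ -v / (ppFreq β n ^ 2 + (v) ^ 2) ≤ 1 / ppFreq β n := by
            right
            rw [div_le_div_iff₀ (by have := hω n; positivity) (hω n)]
            nlinarith [sq_nonneg (ppFreq β n + v), sq_nonneg (ppFreq β n - (-v)), hω n]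
          rcases h4 with h4 | h4
          · have h5 : -(v / (ppFreq β n ^ 2 + v ^ 2)) = -v / (ppFreq β n ^ 2 + v ^ 2) := by ring
            rw [h5]; exact (this.trans h4)
          · have h5 : -(v / (ppFreq β n ^ 2 + v ^ 2)) = -v / (ppFreq β n ^ 2 + v ^ 2) := by ring
            rw [h5]; exact h4.trans (hωπ n)
      · rw [abs_of_nonneg (lorentzian_nonneg _ hv.le)]
        have h4 : v / (ppFreq β n ^ 2 + v ^ 2) ≤ 1 / ppFreq β n := by
          rw [div_le_div_iff₀ (by have := hω n; positivity) (hω n)]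
          nlinarith [sq_nonneg (ppFreq β n - v), hω n]
        exact h4.trans (hωπ n)
    have hL' : |(ppFreq β n ^ 2 - v ^ 2) / (ppFreq β n ^ 2 + v ^ 2) ^ 2| ≤ 1 / (ppFreq β n ^ 2 + 0 ^ 2) := by
      rw [zero_pow two_ne_zero, add_zero]; exact abs_lorentzian_deriv_le (hω n).ne' v
    calc |uvWeightFn Λ (ppFreq β n) e| *
          |uvWeightFnD1 Λ (ppFreq β n) v * (e / (ppFreq β n ^ 2 + e ^ 2) + v / (ppFreq β n ^ 2 + v ^ 2)) +
            uvWeightFn Λ (ppFreq β n) v * ((ppFreq β n ^ 2 - v ^ 2) / (ppFreq β n ^ 2 + v ^ 2) ^ 2)|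
        ≤ 1 * (2 * B₁ / Λ * (2 * Λ ^ 2 / (ppFreq β n ^ 2 + Λ ^ 2)) * (|e| * (β / π) ^ 2 + β / π) + 1 / (ppFreq β n ^ 2 + 0 ^ 2)) := by
          refine mul_le_mul hWe ?_ (abs_nonneg _) zero_le_one
          refine (abs_add_le _ _).trans (add_le_add ?_ ?_)
          · rw [abs_mul]
            exact mul_le_mul hD1 ((abs_add_le _ _).trans (add_le_add hLe hLv)) (abs_nonneg _) (by positivity)
          · rw [abs_mul]
            calc |uvWeightFn Λ (ppFreq β n) v| * |(ppFreq β n ^ 2 - v ^ 2) / (ppFreq β n ^ 2 + v ^ 2) ^ 2|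
                ≤ 1 * (1 / (ppFreq β n ^ 2 + 0 ^ 2)) := mul_le_mul hWv hL' (abs_nonneg _) zero_le_one
              _ = 1 / (ppFreq β n ^ 2 + 0 ^ 2) := one_mul _
      _ = _ := one_mul _
  · -- convergence at `v = 0`
    have h0 : ∀ n : ℕ, uvWeightFn Λ (ppFreq β n) e * uvWeightFn Λ (ppFreq β n) 0 *
        (e / (ppFreq β n ^ 2 + e ^ 2) + 0 / (ppFreq β n ^ 2 + 0 ^ 2)) =
        uvWeightFn Λ (ppFreq β n) e * uvWeightFn Λ (ppFreq β n) 0 * (e / (ppFreq β n ^ 2 + e ^ 2)) := fun n => by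
      rw [zero_div, add_zero]
    simp_rw [h0]
    refine Summable.of_norm_bounded ((summable_one_div_ppFreq_sq_add_sq hβ 0).mul_left |e|) fun n => ?_
    rw [Real.norm_eq_abs, abs_mul, abs_mul, zero_pow two_ne_zero, add_zero]
    have h1 := abs_lorentzian_le_abs_div_sq (hω n).ne' e
    calc |uvWeightFn Λ (ppFreq β n) e| * |uvWeightFn Λ (ppFreq β n) 0| * |e / (ppFreq β n ^ 2 + e ^ 2)|
        ≤ 1 * 1 * (|e| / ppFreq β n ^ 2) :=
          mul_le_mul (mul_le_mul (abs_uvWeightFn_le_one _ _ _) (abs_uvWeightFn_le_one _ _ _) (abs_nonneg _) zero_le_one) h1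
            (abs_nonneg _) (by positivity)
      _ = |e| * (1 / ppFreq β n ^ 2) := by ring

/-- **`∂ₑN` exists everywhere**: `∂ₑN(e,u) = ppTrueNumeratorDu β Λ u e` (by the symmetry). [cite: BenfattoGiulianiMastropietro2006, §2.4 (2.36)] -/
theorem hasDerivAt_ppTrueNumerator_e {β Λ : ℝ} (hβ : 0 < β) (hΛ : 0 < Λ) {B₁ : ℝ} (hB₁ : ∀ x, |deriv salmhoferCutoff x| ≤ B₁) (e u : ℝ) :
    HasDerivAt (fun x => ppTrueNumerator β Λ x u) (ppTrueNumeratorDu β Λ u e) e := by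
  have h := hasDerivAt_ppTrueNumerator_u hβ hΛ hB₁ u e
  have hfun : (fun x => ppTrueNumerator β Λ x u) = fun x => ppTrueNumerator β Λ u x := funext fun x => ppTrueNumerator_symm β Λ x u
  rw [hfun]
  exact h

end Summit.HubbardSuperconductivity.HubbardSuperconductivity.Theorems.C4a

end
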